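import Literature.AnabelianGeometry.EtaleTheta.Discharge.Sec2InertiaClauseEllFree
import HarnessLib

/-!
# [EtTh] §2 over §1: the `l`-free inertia clause in the ROOT fields `toTheta` / `thetaToEll` —
# «`D_x → Π^Θ_X` maps `I_x` onto `Δ_Θ`» ⟺ the per-`l` clauses for all `l > 0`

S. Mochizuki, *The étale theta function and its Frobenioid-theoretic manifestations*, Publ. RIMS **45**
(2009) [EtTh], §1 p. 12 («`Π^tp_X ↠ (Π^tp_X)^Θ ↠ (Π^tp_X)^ell` … induced by `Δ_X ↠ Δ^Θ_X ↠ Δ^ell_X`»)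
and §2 p. 35 (printed 261): «there is a natural injective [outer] homomorphism `D_x → Π^Θ_X` … which maps
the inertia group `I_x ⊆ D_x` isomorphically onto `Δ_Θ`» [cite: MochizukiEtTh2009, Def 2.1 p.35].

Cell abc-iut, layer L2; seat abc-iut-w6-d059 (gen 3); sequel of `Sec2InertiaClauseEllFree` (row R205).
PROOF-ONLY (0 definitions).  There, for a compact decomposition group, the per-`l` inertia clauses
`toHat(I_x) ⊔ barKerHat l = barThetaHat l` (all `l > 0`) were shown equivalent to the single clause
`toHat(I_x) ⊔ [Δ_X,[Δ_X,Δ_X]]⁻ = [Δ_X,Δ_X]⁻` inside the profinite `Π_X`.  Here that clause is moved to the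
TEMPERED side and stated in the root fields of `ThetaSetting` (`toTheta`, `thetaToEll`, axioms
`ker_toTheta`, `ker_toEll`, `toTheta_surjective`):

* `commutator_topologicalClosure_le` (`⁅A⁻,B⁻⁆ ≤ ⁅A,B⁆⁻` in any topological group), whence
  `commutatorClosure_eq_closure_map_commutator_deltaTemp`: `[Δ_X,Δ_X]⁻ = (toHat [Δ^tp_X,Δ^tp_X])⁻`;
* `map_sup_closure_eq_iff_sup_comap_eq`: for `I ≤ Π^tp_X` with compact `toHat(I)`,
  «`toHat(I) ⊔ [Δ_X,[Δ_X,Δ_X]]⁻ = [Δ_X,Δ_X]⁻`» ⟺ «`I · Ker(Π^tp_X ↠ (Π^tp_X)^Θ) = Ker(Π^tp_X ↠ (Π^tp_X)^ell)`»;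
* `map_sup_closure_eq_iff_map_toTheta_eq_ker`: ⟺ «`toTheta(I) = Ker(thetaToEll)`» (`= Δ_Θ ⊆ (Π^tp_X)^Θ`);
* **`inertiaClause_forall_iff_map_toTheta`** (compact `D_x`): `∀ l > 0, toHat(I_x) ⊔ barKerHat l =
  barThetaHat l` ⟺ `toTheta(I_x) = Ker(thetaToEll)` — print's sentence, no `l`, no basis of `Δ_X`;
  consumer form `PiCData.inertia_sup_barKer_of_map_toTheta` (the binder `hIx` of `coverDataAx`, `l > 0`).

Every clause is a HYPOTHESIS on the abstract `ThetaSetting`; no model is claimed to satisfy any; no new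
`Prop` fact, no definition, no edit of another seat's file; no side taken on [IUTchIII] Cor. 3.12.
-/

noncomputable section

namespace Literature.AnabelianGeometry.EtaleTheta

open scoped commutatorElement Pointwise
open _root_.Topology Literature.AnabelianGeometry.SemiGraphs

namespace ThetaSetting

variable {p : ℕ} [Fact p.Prime] (D : ThetaSetting p)

/-- In any topological group: commutators of closures lie in the closure of the commutator,
`⁅A⁻, B⁻⁆ ≤ ⁅A, B⁆⁻` (continuity of `(x, y) ↦ [x, y]`). [cite: MochizukiEtTh2009, Def 2.1 p.35] -/
theorem commutator_topologicalClosure_le {G : Type*} [Group G] [TopologicalSpace G]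
    [IsTopologicalGroup G] (A B : Subgroup G) :
    ⁅A.topologicalClosure, B.topologicalClosure⁆ ≤ (⁅A, B⁆).topologicalClosure := by
  rw [Subgroup.commutator_def, Subgroup.closure_le]
  rintro _ ⟨a, ha, b, hb, rfl⟩
  change ⁅a, b⁆ ∈ closure ((⁅A, B⁆ : Subgroup G) : Set G)
  have hcont : Continuous fun q : G × G => ⁅q.1, q.2⁆ := by
    simp only [commutatorElement_def]; fun_prop
  have hab : (a, b) ∈ closure ((A : Set G) ×ˢ (B : Set G)) := by
    rw [closure_prod_eq]; exact ⟨ha, hb⟩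
  have himg := image_closure_subset_closure_image hcont ⟨(a, b), hab, rfl⟩
  refine closure_mono ?_ himg
  rintro _ ⟨⟨a', b'⟩, ⟨ha', hb'⟩, rfl⟩
  exact Subgroup.commutator_mem_commutator ha' hb'

/-- `[Δ^tp_X, Δ^tp_X]` maps into `[Δ_X,Δ_X]⁻` along `toHat`: `⁅Δ^tp,Δ^tp⁆ ≤ toHat⁻¹([Δ_X,Δ_X]⁻)`.
[cite: MochizukiEtTh2009, §1 p.12] -/
theorem commutator_deltaTemp_le_comap :
    ⁅D.DeltaTemp, D.DeltaTemp⁆ ≤ ((⁅D.DeltaHat, D.DeltaHat⁆).topologicalClosure).comap D.toHat.toMonoidHom := by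
  rw [← Subgroup.map_le_iff_le_comap, Subgroup.map_commutator]
  refine le_trans (Subgroup.commutator_mono ?_ ?_) (Subgroup.le_topologicalClosure _) <;>
    exact Subgroup.le_topologicalClosure _

/-- `[Δ_X,Δ_X]⁻` is the closure of `toHat([Δ^tp_X,Δ^tp_X])` (`Δ_X` is the closure of `toHat(Δ^tp_X)`;
commutators of closures lie in the closure of the commutator). [cite: MochizukiEtTh2009, §1 p.12] -/
theorem commutatorClosure_eq_closure_map_commutator_deltaTemp :
    (⁅D.DeltaHat, D.DeltaHat⁆).topologicalClosure =
      ((⁅D.DeltaTemp, D.DeltaTemp⁆).map D.toHat.toMonoidHom).topologicalClosure := by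
  refine le_antisymm ?_ ?_
  · refine Subgroup.topologicalClosure_minimal _ ?_ (Subgroup.isClosed_topologicalClosure _)
    rw [Subgroup.map_commutator]
    exact commutator_topologicalClosure_le _ _
  · refine Subgroup.topologicalClosure_minimal _ ?_ (Subgroup.isClosed_topologicalClosure _)
    rw [Subgroup.map_le_iff_le_comap]
    exact D.commutator_deltaTemp_le_comap

/-- **Profinite ⟺ tempered form of the `l`-free clause**: for a subgroup `I ≤ Π^tp_X` with compact image
`toHat(I)`, «`toHat(I) ⊔ [Δ_X,[Δ_X,Δ_X]]⁻ = [Δ_X,Δ_X]⁻` in `Π_X`» iff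
«`I ⊔ toHat⁻¹([Δ_X,[Δ_X,Δ_X]]⁻) = toHat⁻¹([Δ_X,Δ_X]⁻)` in `Π^tp_X`» — i.e. iff
`I · Ker(Π^tp_X ↠ (Π^tp_X)^Θ) = Ker(Π^tp_X ↠ (Π^tp_X)^ell)`. [cite: MochizukiEtTh2009, §1 p.12] -/
theorem map_sup_closure_eq_iff_sup_comap_eq (I : Subgroup D.PiTemp)
    (hI : IsCompact (((I.map D.toHat.toMonoidHom : Subgroup D.PiHat)) : Set D.PiHat)) :
    I.map D.toHat.toMonoidHom ⊔ (⁅⁅D.DeltaHat, D.DeltaHat⁆, D.DeltaHat⁆).topologicalClosure =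
        (⁅D.DeltaHat, D.DeltaHat⁆).topologicalClosure ↔
      I ⊔ ((⁅⁅D.DeltaHat, D.DeltaHat⁆, D.DeltaHat⁆).topologicalClosure).comap D.toHat.toMonoidHom =
        ((⁅D.DeltaHat, D.DeltaHat⁆).topologicalClosure).comap D.toHat.toMonoidHom := by
  haveI := D.tripleCommutatorClosure_normal
  set N := (⁅⁅D.DeltaHat, D.DeltaHat⁆, D.DeltaHat⁆).topologicalClosure with hN
  set T := (⁅D.DeltaHat, D.DeltaHat⁆).topologicalClosure with hT
  have hNT : N ≤ T := D.tripleCommutatorClosure_le_commutatorClosure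
  constructor
  · intro hE
    refine le_antisymm (sup_le ?_ (Subgroup.comap_mono hNT)) fun g hg => ?_
    · rw [← Subgroup.map_le_iff_le_comap]; exact le_sup_left.trans hE.le
    · have hg' : D.toHat.toMonoidHom g ∈ I.map D.toHat.toMonoidHom ⊔ N := by rw [hE]; exact hg
      obtain ⟨t, ht, n, hn, htn⟩ := Subgroup.mem_sup_of_normal_right.mp hg'
      obtain ⟨i, hi, rfl⟩ := Subgroup.mem_map.mp ht
      have hmem : i⁻¹ * g ∈ N.comap D.toHat.toMonoidHom := by
        change D.toHat.toMonoidHom (i⁻¹ * g) ∈ N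
        rw [map_mul, map_inv, ← htn, inv_mul_cancel_left]
        exact hn
      have hg'' : g = i * (i⁻¹ * g) := by rw [mul_inv_cancel_left]
      rw [hg'']
      exact Subgroup.mul_mem_sup hi hmem
  · intro hE
    refine le_antisymm (sup_le ?_ hNT) ?_
    · rw [Subgroup.map_le_iff_le_comap, ← hE]; exact le_sup_left
    · have hclosed : IsClosed ((I.map D.toHat.toMonoidHom ⊔ N : Subgroup D.PiHat) : Set D.PiHat) := by
        rw [Subgroup.mul_normal]
        exact (Subgroup.isClosed_topologicalClosure _).mul_left_of_isCompact hI
      rw [hT, D.commutatorClosure_eq_closure_map_commutator_deltaTemp]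
      refine Subgroup.topologicalClosure_minimal _ ?_ hclosed
      calc (⁅D.DeltaTemp, D.DeltaTemp⁆).map D.toHat.toMonoidHom
          ≤ (I ⊔ N.comap D.toHat.toMonoidHom).map D.toHat.toMonoidHom :=
            Subgroup.map_mono (hE.symm ▸ D.commutator_deltaTemp_le_comap)
        _ ≤ I.map D.toHat.toMonoidHom ⊔ N := by
            rw [Subgroup.map_sup]; exact sup_le_sup_left (Subgroup.map_comap_le _ _) _

/-- **The `l`-free clause in the ROOT fields of `ThetaSetting`**: for `I ≤ Π^tp_X` with compact `toHat(I)`,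
«`toHat(I) ⊔ [Δ_X,[Δ_X,Δ_X]]⁻ = [Δ_X,Δ_X]⁻`» iff «`toTheta(I) = Ker((Π^tp_X)^Θ ↠ (Π^tp_X)^ell)`», i.e.
`I` maps ONTO `Δ_Θ = Ker(thetaToEll)` under `Π^tp_X ↠ (Π^tp_X)^Θ` (root axioms `ker_toTheta`,
`ker_toEll`, `toTheta_surjective`). [cite: MochizukiEtTh2009, Def 2.1 p.35] -/
theorem map_sup_closure_eq_iff_map_toTheta_eq_ker (I : Subgroup D.PiTemp)
    (hI : IsCompact (((I.map D.toHat.toMonoidHom : Subgroup D.PiHat)) : Set D.PiHat)) :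
    I.map D.toHat.toMonoidHom ⊔ (⁅⁅D.DeltaHat, D.DeltaHat⁆, D.DeltaHat⁆).topologicalClosure =
        (⁅D.DeltaHat, D.DeltaHat⁆).topologicalClosure ↔
      I.map D.toTheta = D.thetaToEll.ker := by
  rw [D.map_sup_closure_eq_iff_sup_comap_eq I hI]
  have hker : D.thetaToEll.ker = ((D.thetaToEll.comp D.toTheta).ker).map D.toTheta := by
    rw [← MonoidHom.comap_ker, Subgroup.map_comap_eq_self_of_surjective D.toTheta_surjective]
  have hkerT : D.toTheta.ker =
      ((⁅⁅D.DeltaHat, D.DeltaHat⁆, D.DeltaHat⁆).topologicalClosure).comap D.toHat.toMonoidHom :=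
    D.ker_toTheta
  have hkerE : (D.thetaToEll.comp D.toTheta).ker =
      ((⁅D.DeltaHat, D.DeltaHat⁆).topologicalClosure).comap D.toHat.toMonoidHom := D.ker_toEll
  rw [hker, Subgroup.map_eq_map_iff, hkerT, hkerE]
  have hle : ((⁅⁅D.DeltaHat, D.DeltaHat⁆, D.DeltaHat⁆).topologicalClosure).comap D.toHat.toMonoidHom ≤
      ((⁅D.DeltaHat, D.DeltaHat⁆).topologicalClosure).comap D.toHat.toMonoidHom :=
    Subgroup.comap_mono D.tripleCommutatorClosure_le_commutatorClosure
  rw [sup_eq_left.mpr hle]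

/-- **MAIN (R205).  Per-`l` inertia clauses for ALL `l > 0` ⟺ print's `l`-free sentence** (compact
`D_x`): `∀ l > 0, toHat(I_x) ⊔ barKerHat l = barThetaHat l` holds iff
`toTheta(I_x) = Ker((Π^tp_X)^Θ ↠ (Π^tp_X)^ell)` — «`D_x → Π^Θ_X` maps the inertia group `I_x` onto `Δ_Θ`»
(p. 35), stated in the root fields `toTheta` / `thetaToEll` of `ThetaSetting`, no `l`, no basis of `Δ_X`.
[cite: MochizukiEtTh2009, Def 2.1 p.35] -/
theorem inertiaClause_forall_iff_map_toTheta (x : D.Pt) (hcpt : IsCompact (D.decomp x : Set D.PiTemp)) :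
    (∀ l, 0 < l → (D.inertia x).map D.toHat.toMonoidHom ⊔ D.barKerHat l = D.barThetaHat l) ↔
      (D.inertia x).map D.toTheta = D.thetaToEll.ker := by
  rw [D.inertiaClause_forall_iff_closure x hcpt,
    D.map_sup_closure_eq_iff_map_toTheta_eq_ker _ (D.isCompact_map_inertia x hcpt)]

/-- **Consumer direction, every `l > 0`**: from the `l`-free clause «`toTheta(I_x) = Δ_Θ`» (compact `D_x`)
the §1-side per-`l` clause of `Sec2InertiaBinderOfHat` follows for every `l > 0`.
[cite: MochizukiEtTh2009, Def 2.1 p.35] -/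
theorem inertiaClause_of_map_toTheta (x : D.Pt) (hcpt : IsCompact (D.decomp x : Set D.PiTemp))
    (h : (D.inertia x).map D.toTheta = D.thetaToEll.ker) (l : ℕ) (hl : 0 < l) :
    (D.inertia x).map D.toHat.toMonoidHom ⊔ D.barKerHat l = D.barThetaHat l :=
  (D.inertiaClause_forall_iff_map_toTheta x hcpt).mpr h l hl

namespace PiCData

variable {D} {PiC : Type} [Group PiC] [TopologicalSpace PiC] [IsTopologicalGroup PiC] [T2Space PiC]
  (I : D.PiCData PiC)

/-- **The binder `hIx` of `coverDataAx` from the `l`-free clause**: for every profinite input bundle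
`I : D.PiCData PiC`, a cusp `x` with compact decomposition group such that `toTheta(I_x) = Δ_Θ`, and every
`l > 0`: `(D_x ∩ Δ_C) · barKer l = barTheta l` inside `Π_C`. [cite: MochizukiEtTh2009, Def 2.1 p.35] -/
theorem inertia_sup_barKer_of_map_toTheta (l : ℕ) (hl : 0 < l) (e : D.OncePuncturedData) (x : D.Pt)
    (hcpt : IsCompact (D.decomp x : Set D.PiTemp))
    (h : (D.inertia x).map D.toTheta = D.thetaToEll.ker) :
    (I.Dx x ⊓ I.augGK.ker) ⊔ I.barKer l = I.barTheta l :=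
  I.inertia_sup_barKer_of_inertia l e x hcpt (D.inertiaClause_of_map_toTheta x hcpt h l hl)

end PiCData

/-! ### Appendix (abc-iut-w6-d059, census S1-3 / C3 consumer path): CLOSED IMAGE `toHat(I_x)` suffices

The cusp-level statements above take `IsCompact D_x`.  The K1 bridge needs only that the IMAGE `toHat(I_x)` be
closed in the profinite `Π_X` (then compact) — e.g. at abc-iut-w5-d165's `model₂ᶜ`, where `D_x` itself is NOT
compact (`SettingModel.not_isCompact_decomp_model₂c`) but `toHat(I_x) = ⟨[a,b]⟩⁻` is closed.  The predicate of
record `∀ x, IsCusp x → (inertia x).map toTheta = thetaToEll.ker` therefore needs no compactness conjunct;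
consumers supply `IsClosed (toHat(I_x))` as their own side input (a theorem at tempered data,
`TemperedCurve.isCompact_decomp_of_isTempered`, and at `model₂ᶜ`). -/

/-- A CLOSED image `toHat(I_x) ≤ Π_X` is compact (`Π_X` is profinite). [cite: MochizukiEtTh2009, Def 2.1 p.35] -/
theorem isCompact_map_inertia_of_isClosed (x : D.Pt)
    (hI : IsClosed (((D.inertia x).map D.toHat.toMonoidHom : Subgroup D.PiHat) : Set D.PiHat)) :
    IsCompact (((D.inertia x).map D.toHat.toMonoidHom : Subgroup D.PiHat) : Set D.PiHat) := by
  haveI : CompactSpace D.PiHat := D.isProfiniteCompletion_toHat.compactSpace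
  exact hI.isCompact

/-- **K1 with a closed image only**: if `toHat(I_x)` is closed in `Π_X`, the per-`l` inertia clauses for all
`l > 0` hold iff `toTheta(I_x) = Ker((Π^tp_X)^Θ ↠ (Π^tp_X)^ell)` — no compactness of `D_x` in `Π^tp_X` needed.
[cite: MochizukiEtTh2009, Def 2.1 p.35] -/
theorem inertiaClause_forall_iff_map_toTheta_of_isClosed (x : D.Pt)
    (hI : IsClosed (((D.inertia x).map D.toHat.toMonoidHom : Subgroup D.PiHat) : Set D.PiHat)) :
    (∀ l, 0 < l → (D.inertia x).map D.toHat.toMonoidHom ⊔ D.barKerHat l = D.barThetaHat l) ↔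
      (D.inertia x).map D.toTheta = D.thetaToEll.ker := by
  rw [D.forall_sup_barKerHat_eq_iff _ (D.isCompact_map_inertia_of_isClosed x hI),
    D.map_sup_closure_eq_iff_map_toTheta_eq_ker _ (D.isCompact_map_inertia_of_isClosed x hI)]

/-- **Consumer direction with a closed image, EVERY `l`** (also `l = 0`): from «`toTheta(I_x) = Δ_Θ`» and
`toHat(I_x)` closed, `toHat(I_x) ⊔ barKerHat l = barThetaHat l`. [cite: MochizukiEtTh2009, Def 2.1 p.35] -/
theorem inertiaClause_of_map_toTheta_of_isClosed (x : D.Pt)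
    (hI : IsClosed (((D.inertia x).map D.toHat.toMonoidHom : Subgroup D.PiHat) : Set D.PiHat))
    (h : (D.inertia x).map D.toTheta = D.thetaToEll.ker) (l : ℕ) :
    (D.inertia x).map D.toHat.toMonoidHom ⊔ D.barKerHat l = D.barThetaHat l :=
  D.sup_barKerHat_eq_of_sup_closure_eq _ (D.isCompact_map_inertia_of_isClosed x hI)
    ((D.map_sup_closure_eq_iff_map_toTheta_eq_ker _ (D.isCompact_map_inertia_of_isClosed x hI)).mpr h) l

/-- For a compact `D_x` the image `toHat(I_x)` is closed (so the `_of_isClosed` forms subsume the compact ones).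
[cite: MochizukiEtTh2009, Def 2.1 p.35] -/
theorem isClosed_map_inertia_of_isCompact (x : D.Pt) (hcpt : IsCompact (D.decomp x : Set D.PiTemp)) :
    IsClosed (((D.inertia x).map D.toHat.toMonoidHom : Subgroup D.PiHat) : Set D.PiHat) := by
  haveI : T2Space D.PiHat := D.isProfiniteCompletion_toHat.t2Space
  exact (D.isCompact_map_inertia x hcpt).isClosed

end ThetaSetting

end Literature.AnabelianGeometry.EtaleTheta

end
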